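import Summits.Ventures.Crystal3D.Theorems.StickyWulffConstantTextureLiminfTexShadowCornerHollow
import HarnessLib

/-!
# EDGE-ON corner, plan of record (cf-p1 (clii)/(clxv)), helper H2(i): the BARLOW SITE LATTICE `Γ` and the coset algebra of coincidences
# (lane T crux `TextureLiminfV5`, stmt-Ventures-23912, registered stub `stub_edgeOnSteep`; 19480-p2 g12)

HONEST FRAMING. Venture `Summits/Ventures/Crystal3D` (cell `crystal3d-full`), route `route-Ventures-StickyWulffConstant`, helper `--supports` the
law-v5 crux `TextureLiminfV5` (stmt-Ventures-23912).  One definition + elementary abelian-group bookkeeping, standard axioms; no wall statement;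
F-C1 not moved.

THE POINT.  H1 (`hollow_of_three_contacts`, …TexShadowCornerHollow) pins a ball with three contacts to a complete layer `k` of a plate's layer system
to a site of letter `L+1` or `L+2` at height `(k+1)√(2/3)`.  ALL letter sites `A/B/C` at ALL integer heights of the model layer system form ONE
three-dimensional lattice, the **Barlow site lattice** `Γ := ℤ·w ⊕ ℤ·a₁ ⊕ ℤ·c` (`w = barlowOffset 1`, `a₁ = triangularVec₁ 1`, `c = layerNormal √(2/3)`;
`a₂ = 3w − a₁`; index `3` over the fcc lattice) — INDEPENDENT of the Hägg word: every Barlow stacking `barlowStacking 1 √(2/3) σ` and every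
continuation site lies in `Γ`.  So «continuable with respect to plate i» (in the weakest sense H2 needs) reads `y ∈ Lᵢ·Γ + sᵢ`, a LATTICE COSET even
for faulted plates, and the both-continuable set of two plates is an intersection of two lattice cosets, which is empty or a coset of the
intersection subgroup (H2(i); H2(ii)–(iv) = rank/planarity, the Σ-lemma, counting — separate files).
* `barlowSiteLattice` (`Γ`) and `triangularVec₂_mem_siteLattice`, **`barlowPos_mem_siteLattice`** (every site of every Barlow stacking of the model
  layer system is in `Γ`), **`letterSite_mem_siteLattice`** (H1's letter sites, any letter shift `e : ℤ`, are in `Γ`);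
* `hollow_of_three_contacts_mem_siteLattice` — H1 ∘ the above: three contacts over a complete layer ⇒ `q ∈ Γ`;
* **`inter_coset_eq_coset_inf`** / `inter_coset_empty_or_coset` — `{y | y − a ∈ H} ∩ {y | y − b ∈ K}` is empty or `{y | y − x ∈ H ⊓ K}` (any
  additive commutative group).
WHAT THIS IS NOT: no rank / index / counting statement (H2(ii)–(iv)), no coaxiality lemma (H2(iii)); F-C1 not moved.
-/

noncomputable section

namespace Summit.Ventures.Crystal3D.Theorems

open Literature.MathematicalPhysics.StatisticalMechanics
open scoped InnerProductSpace

/-! ## The Barlow site lattice -/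

/-- **The Barlow site lattice `Γ = ℤ·w ⊕ ℤ·a₁ ⊕ ℤ·c`** of the model layer system (`w = barlowOffset 1`, `a₁ = triangularVec₁ 1`,
`c = layerNormal √(2/3)`): all letter positions `A/B/C` at every integer height. -/
def barlowSiteLattice : AddSubgroup (EuclideanSpace ℝ (Fin 3)) :=
  AddSubgroup.closure {barlowOffset 1, triangularVec₁ 1, layerNormal (Real.sqrt (2 / 3))}

/-- `w ∈ Γ`. -/
theorem barlowOffset_mem_siteLattice : barlowOffset 1 ∈ barlowSiteLattice :=
  AddSubgroup.subset_closure (by simp)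

/-- `a₁ ∈ Γ`. -/
theorem triangularVec₁_mem_siteLattice : triangularVec₁ 1 ∈ barlowSiteLattice :=
  AddSubgroup.subset_closure (by simp)

/-- `c ∈ Γ`. -/
theorem layerNormal_mem_siteLattice : layerNormal (Real.sqrt (2 / 3)) ∈ barlowSiteLattice :=
  AddSubgroup.subset_closure (by simp)

/-- `a₂ = 3w − a₁ ∈ Γ`. -/
theorem triangularVec₂_mem_siteLattice : triangularVec₂ 1 ∈ barlowSiteLattice := by
  have h3 : triangularVec₂ 1 = (3 : ℤ) • barlowOffset 1 - triangularVec₁ 1 := by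
    have h := three_smul_barlowOffset (1 : ℝ)
    rw [← Int.cast_smul_eq_zsmul ℝ]; push_cast
    rw [h]; abel
  rw [h3]
  exact barlowSiteLattice.sub_mem (barlowSiteLattice.zsmul_mem barlowOffset_mem_siteLattice 3) triangularVec₁_mem_siteLattice

/-- An integer combination `i•a₁ + j•a₂ + l•w + k•c` (real scalars that are integer casts) is in `Γ`. -/
theorem intCombo_mem_siteLattice (i j l k : ℤ) :
    (i : ℝ) • triangularVec₁ 1 + (j : ℝ) • triangularVec₂ 1 + (l : ℝ) • barlowOffset 1 + (k : ℝ) • layerNormal (Real.sqrt (2 / 3))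
      ∈ barlowSiteLattice := by
  rw [Int.cast_smul_eq_zsmul ℝ, Int.cast_smul_eq_zsmul ℝ, Int.cast_smul_eq_zsmul ℝ, Int.cast_smul_eq_zsmul ℝ]
  exact barlowSiteLattice.add_mem (barlowSiteLattice.add_mem (barlowSiteLattice.add_mem
    (barlowSiteLattice.zsmul_mem triangularVec₁_mem_siteLattice i) (barlowSiteLattice.zsmul_mem triangularVec₂_mem_siteLattice j))
    (barlowSiteLattice.zsmul_mem barlowOffset_mem_siteLattice l)) (barlowSiteLattice.zsmul_mem layerNormal_mem_siteLattice k)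

/-- **Every site of every Barlow stacking of the model layer system is in `Γ`** (any Hägg word `σ`). -/
theorem barlowPos_mem_siteLattice (σ : ℤ → ℤ) (k i j : ℤ) : barlowPos 1 (Real.sqrt (2 / 3)) σ k i j ∈ barlowSiteLattice :=
  intCombo_mem_siteLattice i j (haggLabel σ k) k

/-- The whole stacking is in `Γ`. -/
theorem barlowStacking_subset_siteLattice (σ : ℤ → ℤ) :
    barlowStacking 1 (Real.sqrt (2 / 3)) σ ⊆ (barlowSiteLattice : Set (EuclideanSpace ℝ (Fin 3))) := by
  rintro x ⟨k, i, j, rfl⟩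
  exact barlowPos_mem_siteLattice σ k i j

/-- **H1's letter sites are in `Γ`**: a point with coordinates `(i + j/2 + (L+e)/2, (√3/2)(j + (L+e)/3), (k+1)√(2/3))` (`L = haggLabel σ k`,
ANY integer letter shift `e`) is the integer combination `i•a₁ + j•a₂ + (L+e)•w + (k+1)•c`. -/
theorem letterSite_mem_siteLattice (σ : ℤ → ℤ) (k : ℤ) (q : EuclideanSpace ℝ (Fin 3)) {e i j : ℤ}
    (hz : q 2 = ((k : ℝ) + 1) * Real.sqrt (2 / 3))
    (hx : q 0 = i + j / 2 + ((haggLabel σ k : ℝ) + e) / 2) (hy : q 1 = Real.sqrt 3 / 2 * (j + ((haggLabel σ k : ℝ) + e) / 3)) :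
    q ∈ barlowSiteLattice := by
  have hq : q = ((i : ℤ) : ℝ) • triangularVec₁ 1 + ((j : ℤ) : ℝ) • triangularVec₂ 1 + ((haggLabel σ k + e : ℤ) : ℝ) • barlowOffset 1 +
      ((k + 1 : ℤ) : ℝ) • layerNormal (Real.sqrt (2 / 3)) := by
    ext t
    fin_cases t
    · simp [hx, triangularVec₁, triangularVec₂, barlowOffset, layerNormal]; ring
    · simp [hy, triangularVec₁, triangularVec₂, barlowOffset, layerNormal]; ring
    · simp [hz, triangularVec₁, triangularVec₂, barlowOffset, layerNormal]
  rw [hq]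
  exact intCombo_mem_siteLattice i j (haggLabel σ k + e) (k + 1)

/-- **H1 ⇒ Γ**: three contacts over a complete layer put the ball in the Barlow site lattice (model frame). -/
theorem hollow_of_three_contacts_mem_siteLattice (σ : ℤ → ℤ) (k : ℤ) (q : EuclideanSpace ℝ (Fin 3))
    (habove : (k : ℝ) * Real.sqrt (2 / 3) < q 2)
    (hcore : ∀ i j : ℤ, (q 0 - barlowPos 1 (Real.sqrt (2 / 3)) σ k i j 0) ^ 2 +
        (q 1 - barlowPos 1 (Real.sqrt (2 / 3)) σ k i j 1) ^ 2 ≤ 1 / 3 →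
      1 ≤ ‖q - barlowPos 1 (Real.sqrt (2 / 3)) σ k i j‖)
    (S : Finset (ℤ × ℤ)) (hS3 : 3 ≤ S.card)
    (hS : ∀ ij ∈ S, ‖q - barlowPos 1 (Real.sqrt (2 / 3)) σ k ij.1 ij.2‖ = 1) :
    q ∈ barlowSiteLattice := by
  obtain ⟨hz, e, i, j, -, hx, hy⟩ := hollow_of_three_contacts σ k q habove hcore S hS3 hS
  exact letterSite_mem_siteLattice σ k q hz hx hy

/-! ## Coset algebra: the both-continuable set is empty or one coset of the intersection subgroup -/

section Coset

variable {E : Type*} [AddCommGroup E]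

/-- **Two cosets meet in a coset of the intersection**: if `x` lies in both `a + H` and `b + K` then `(a + H) ∩ (b + K) = x + (H ⊓ K)`. -/
theorem inter_coset_eq_coset_inf (H K : AddSubgroup E) (a b x : E) (hxa : x - a ∈ H) (hxb : x - b ∈ K) :
    {y : E | y - a ∈ H} ∩ {y : E | y - b ∈ K} = {y : E | y - x ∈ H ⊓ K} := by
  ext y
  simp only [Set.mem_inter_iff, Set.mem_setOf_eq, AddSubgroup.mem_inf]
  constructor
  · rintro ⟨hya, hyb⟩
    refine ⟨?_, ?_⟩
    · have h := H.sub_mem hya hxa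
      rwa [sub_sub_sub_cancel_right] at h
    · have h := K.sub_mem hyb hxb
      rwa [sub_sub_sub_cancel_right] at h
  · rintro ⟨hyH, hyK⟩
    refine ⟨?_, ?_⟩
    · have h := H.add_mem hyH hxa
      rwa [sub_add_sub_cancel] at h
    · have h := K.add_mem hyK hxb
      rwa [sub_add_sub_cancel] at h

/-- **Dichotomy**: the intersection of two cosets is empty or a coset of `H ⊓ K`. -/
theorem inter_coset_empty_or_coset (H K : AddSubgroup E) (a b : E) :
    {y : E | y - a ∈ H} ∩ {y : E | y - b ∈ K} = ∅ ∨
      ∃ x : E, {y : E | y - a ∈ H} ∩ {y : E | y - b ∈ K} = {y : E | y - x ∈ H ⊓ K} := by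
  rcases Set.eq_empty_or_nonempty ({y : E | y - a ∈ H} ∩ {y : E | y - b ∈ K}) with h | ⟨x, hxa, hxb⟩
  · exact Or.inl h
  · exact Or.inr ⟨x, inter_coset_eq_coset_inf H K a b x hxa hxb⟩

end Coset

/-! ## Framed plates: the continuation coset of a presented layer system -/

/-- **The site coset of a plate presented by `(L, s)`**: `{y | L⁻¹(y − s) ∈ Γ}` = `L·Γ + s`, as the coset of the mapped subgroup
`Γ.map L` through `s`. -/
theorem mem_siteCoset_iff (L : EuclideanSpace ℝ (Fin 3) ≃ₗᵢ[ℝ] EuclideanSpace ℝ (Fin 3)) (s y : EuclideanSpace ℝ (Fin 3)) :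
    L.symm (y - s) ∈ barlowSiteLattice ↔
      y - s ∈ barlowSiteLattice.map (L.toLinearEquiv.toLinearMap.toAddMonoidHom) := by
  constructor
  · intro h
    refine ⟨L.symm (y - s), h, ?_⟩
    simp
  · rintro ⟨x, hx, hxy⟩
    have : x = L.symm (y - s) := by
      have h1 : (L.toLinearEquiv.toLinearMap.toAddMonoidHom) x = L x := rfl
      rw [h1] at hxy
      rw [← hxy, LinearIsometryEquiv.symm_apply_apply]
    rwa [← this]

/-- **H2(i) — the both-continuable set of two presented layer systems is empty or ONE coset of the coincidence subgroup
`(Γ.map L₁) ⊓ (Γ.map L₂)`.** -/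
theorem bothContinuable_empty_or_coset (L₁ L₂ : EuclideanSpace ℝ (Fin 3) ≃ₗᵢ[ℝ] EuclideanSpace ℝ (Fin 3)) (s₁ s₂ : EuclideanSpace ℝ (Fin 3)) :
    {y | L₁.symm (y - s₁) ∈ barlowSiteLattice} ∩ {y | L₂.symm (y - s₂) ∈ barlowSiteLattice} = ∅ ∨
      ∃ x : EuclideanSpace ℝ (Fin 3),
        {y | L₁.symm (y - s₁) ∈ barlowSiteLattice} ∩ {y | L₂.symm (y - s₂) ∈ barlowSiteLattice} =
          {y | y - x ∈ barlowSiteLattice.map (L₁.toLinearEquiv.toLinearMap.toAddMonoidHom) ⊓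
            barlowSiteLattice.map (L₂.toLinearEquiv.toLinearMap.toAddMonoidHom)} := by
  have h₁ : {y | L₁.symm (y - s₁) ∈ barlowSiteLattice} =
      {y | y - s₁ ∈ barlowSiteLattice.map (L₁.toLinearEquiv.toLinearMap.toAddMonoidHom)} := by
    ext y; exact mem_siteCoset_iff L₁ s₁ y
  have h₂ : {y | L₂.symm (y - s₂) ∈ barlowSiteLattice} =
      {y | y - s₂ ∈ barlowSiteLattice.map (L₂.toLinearEquiv.toLinearMap.toAddMonoidHom)} := by
    ext y; exact mem_siteCoset_iff L₂ s₂ y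
  rw [h₁, h₂]
  exact inter_coset_empty_or_coset _ _ s₁ s₂

end Summit.Ventures.Crystal3D.Theorems

end
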